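import Mathlib

/-!
# Resampling identity for finite products of identical probability measures

Helper for the line `crossing-split-integrability` of the phase-quenched flavour-decay crux.
If `x` and `y` are independent samples of the finite product `μ^⊗ι` of a probability measure
`μ`, then the configuration obtained from `x` by replacing its coordinates in a (decidable) set
`p` by those of `y` is again `μ^⊗ι`-distributed. In integrated form, for every measurable
`Φ : (ι → X) → ℝ≥0∞`,

`∫⁻ x, Φ x ∂μ^⊗ι = ∫⁻ x, ∫⁻ y, Φ (fun i => if p i then y i else x i) ∂μ^⊗ι ∂μ^⊗ι`.

In the crux this disintegrates the product (Haar) measure over the links of a star (the fibre,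
selected by `p`) and the remaining links.

The proof goes through Mathlib's marginal integrals `MeasureTheory.lmarginal`
(`∫⋯∫⁻_s, f ∂μ`): with `s = {i | p i}`, the inner integral is the `s`-marginal of `Φ` (the
unused coordinates of `y` integrate to `1`, via `MeasureTheory.lintegral_restrict_infinitePi`),
the `s`-marginal is idempotent for probability measures, and two measurable functions with the
same `s`-marginal have the same full integral (`MeasureTheory.lintegral_eq_of_lmarginal_eq`).
-/

noncomputable section

open MeasureTheory

namespace Summit.QuantumFields.QCD.Cruxes.PhaseQuenchedFlavourDecay.CrossingSplitIntegrability

/-- Taking the `s`-marginal with respect to identical probability measures is idempotent: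
the `s`-marginal of `f` no longer depends on the coordinates in `s`, so integrating them out
once more changes nothing. -/
theorem lmarginal_lmarginal_self {ι X : Type} [DecidableEq ι] [MeasurableSpace X]
    (μ : Measure X) [IsProbabilityMeasure μ] (s : Finset ι) (f : (ι → X) → ENNReal) :
    ∫⋯∫⁻_s, ∫⋯∫⁻_s, f ∂(fun _ : ι => μ) ∂(fun _ : ι => μ) = ∫⋯∫⁻_s, f ∂(fun _ : ι => μ) := by
  funext x
  calc (∫⋯∫⁻_s, ∫⋯∫⁻_s, f ∂(fun _ : ι => μ) ∂(fun _ : ι => μ)) x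
      = ∫⁻ _ : (i : s) → X, (∫⋯∫⁻_s, f ∂(fun _ : ι => μ)) x ∂(Measure.pi fun _ : s => μ) :=
        lintegral_congr fun z => lmarginal_congr _ f fun i hi => by
          simp [Function.updateFinset, hi]
    _ = (∫⋯∫⁻_s, f ∂(fun _ : ι => μ)) x := by
        rw [lintegral_const, measure_univ, mul_one]

/-- The inner resampling integral is the marginal over `s = {i | p i}`: integrating
`Φ (fun i => if p i then y i else x i)` over all of `y` only uses the `p`-coordinates of `y`,
and its remaining coordinates integrate to `1`. -/
theorem lintegral_refit_eq_lmarginal {ι X : Type} [Fintype ι] [DecidableEq ι]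
    [MeasurableSpace X] (μ : Measure X) [IsProbabilityMeasure μ] (p : ι → Prop)
    [DecidablePred p] {Φ : (ι → X) → ENNReal} (hΦ : Measurable Φ) (x : ι → X) :
    ∫⁻ y, Φ (fun i => if p i then y i else x i) ∂(Measure.pi fun _ : ι => μ) =
      (∫⋯∫⁻_(Finset.univ.filter p), Φ ∂(fun _ : ι => μ)) x := by
  set s : Finset ι := Finset.univ.filter p with hs
  have hmem : ∀ i, i ∈ s ↔ p i := fun i => by simp [hs]
  have hmeas : Measurable fun z : (i : s) → X => Φ (Function.updateFinset x s z) :=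
    hΦ.comp measurable_updateFinset
  have h := lintegral_restrict_infinitePi (fun _ : ι => μ) hmeas
  rw [Measure.infinitePi_eq_pi] at h
  calc ∫⁻ y, Φ (fun i => if p i then y i else x i) ∂(Measure.pi fun _ : ι => μ)
      = ∫⁻ y, Φ (Function.updateFinset x s (s.restrict y)) ∂(Measure.pi fun _ : ι => μ) := by
        refine lintegral_congr fun y => ?_
        congr 1
        funext i
        by_cases hi : p i
        · simp only [if_pos hi, Function.updateFinset, dif_pos ((hmem i).2 hi), Finset.restrict]
        · simp only [if_neg hi, Function.updateFinset, dif_neg (mt (hmem i).1 hi)]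
    _ = ∫⁻ z, Φ (Function.updateFinset x s z) ∂(Measure.pi fun _ : s => μ) := h
    _ = (∫⋯∫⁻_s, Φ ∂(fun _ : ι => μ)) x := rfl

/-- **Resampling identity for a finite product of identical probability measures.**
If `x, y` are independent `μ^⊗ι`-samples (`μ` a probability measure) and `p` is a decidable
predicate on the index type, then `fun i => if p i then y i else x i` is again
`μ^⊗ι`-distributed; equivalently, for every measurable `Φ : (ι → X) → ℝ≥0∞`,
`∫⁻ Φ ∂μ^⊗ι = ∫⁻ x, ∫⁻ y, Φ (fun i => if p i then y i else x i) ∂μ^⊗ι ∂μ^⊗ι`. -/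
theorem stub_piResample :
    ∀ (ι : Type) [Fintype ι] [DecidableEq ι] (X : Type) [MeasurableSpace X]
      (μ : MeasureTheory.Measure X) [MeasureTheory.IsProbabilityMeasure μ] (p : ι → Prop)
      [DecidablePred p] (Φ : (ι → X) → ENNReal), Measurable Φ →
        ∫⁻ x, Φ x ∂(MeasureTheory.Measure.pi fun _ : ι => μ) =
          ∫⁻ x, ∫⁻ y, Φ (fun i => if p i then y i else x i)
            ∂(MeasureTheory.Measure.pi fun _ : ι => μ) ∂(MeasureTheory.Measure.pi fun _ : ι => μ) := by
  intro ι _ _ X _ μ _ p _ Φ hΦ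
  have h1 : (fun x : ι → X => ∫⁻ y, Φ (fun i => if p i then y i else x i)
      ∂(Measure.pi fun _ : ι => μ)) = ∫⋯∫⁻_(Finset.univ.filter p), Φ ∂(fun _ : ι => μ) :=
    funext (lintegral_refit_eq_lmarginal μ p hΦ)
  have h2 := lintegral_eq_of_lmarginal_eq (μ := fun _ : ι => μ) (Finset.univ.filter p) hΦ
    (hΦ.lmarginal (s := Finset.univ.filter p) fun _ : ι => μ)
    (lmarginal_lmarginal_self μ (Finset.univ.filter p) Φ).symm
  rw [← h1] at h2
  exact h2

end Summit.QuantumFields.QCD.Cruxes.PhaseQuenchedFlavourDecay.CrossingSplitIntegrability
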